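import Summits.AtomisticToContinuum.Crystallization.Theses.GappedShellCensus

/-!
# Crux `GappedShellCensus.TornFree` (stmt-AtomisticToContinuum-18069), line `Sketch` —
# the COMBINATORIAL TRICHOTOMY of a torn bond (lead c1, skeleton v3.2)

At unit scale with the torn bond based at the origin: in a finite ALLGAP configuration `Y ∋ 0`
(every pair of distinct points at distance `≥ 0.98` and `≤ 1.02` or `≥ 1.26`; at most twelve bonded
neighbours everywhere, exactly twelve within `3` of `0`), a bond `(0, v)` with at most three common
neighbours has at most two of them, or exactly three among which the bond graph has a vertex of
degree two (a HUB common bonded to the other two — word `TTW`) or a vertex of degree zero (a common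
bonded to neither, hence — ALLGAP — FAR from both: words `TWW`, `WWW`).  So the unit-scale finite
form of the crux follows from the three class statements (the registered content stubs
`stub_tfNoSparseBondUnit`, `stub_tfNoHubTriadUnit`, `stub_tfNoFarTriadUnit` of skeleton v3.2,
Cruxes/TornFree/Lines/Sketch.lean), taken here as hypotheses: `tf_trichotomyUnit`.
Pure combinatorics (`Set.ncard_eq_three` + case analysis); no definitions, no named facts.
-/

noncomputable section

namespace Summit.AtomisticToContinuum.Crystallization.Theorems

/-- **The combinatorial trichotomy of a torn bond (skeleton v3.2 glue).** At unit scale: a bond `(0, v)`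
with at most three commons has at most two (`stub_tfNoSparseBondUnit`), or exactly three among
which either some common is bonded to the other two (`stub_tfNoHubTriadUnit`) or some common is
bonded to neither, hence — ALLGAP — far from both (`stub_tfNoFarTriadUnit`). -/
theorem tf_trichotomyUnit :
    (∀ (Y : Set (EuclideanSpace ℝ (Fin 3))), Y.Finite → (0 : EuclideanSpace ℝ (Fin 3)) ∈ Y →
      (∀ p ∈ Y, ∀ q ∈ Y, p ≠ q → 1 - 1 / 50 ≤ dist p q ∧
        (dist p q ≤ 1 + 1 / 50 ∨ 63 / 50 ≤ dist p q)) →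
      (∀ z ∈ Y, {w ∈ Y | w ≠ z ∧ dist z w ≤ 1 + 1 / 50}.ncard ≤ 12) →
      (∀ z ∈ Y, ‖z‖ ≤ 3 → {w ∈ Y | w ≠ z ∧ dist z w ≤ 1 + 1 / 50}.ncard = 12) →
      ∀ v ∈ Y, v ≠ 0 → ‖v‖ ≤ 1 + 1 / 50 →
        {w ∈ Y | w ≠ 0 ∧ w ≠ v ∧ ‖w‖ ≤ 1 + 1 / 50 ∧ dist v w ≤ 1 + 1 / 50}.ncard ≤ 2 →
        False) →
    (∀ (Y : Set (EuclideanSpace ℝ (Fin 3))), Y.Finite → (0 : EuclideanSpace ℝ (Fin 3)) ∈ Y →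
      (∀ p ∈ Y, ∀ q ∈ Y, p ≠ q → 1 - 1 / 50 ≤ dist p q ∧
        (dist p q ≤ 1 + 1 / 50 ∨ 63 / 50 ≤ dist p q)) →
      (∀ z ∈ Y, {w ∈ Y | w ≠ z ∧ dist z w ≤ 1 + 1 / 50}.ncard ≤ 12) →
      (∀ z ∈ Y, ‖z‖ ≤ 3 → {w ∈ Y | w ≠ z ∧ dist z w ≤ 1 + 1 / 50}.ncard = 12) →
      ∀ v ∈ Y, v ≠ 0 → ‖v‖ ≤ 1 + 1 / 50 →
        {w ∈ Y | w ≠ 0 ∧ w ≠ v ∧ ‖w‖ ≤ 1 + 1 / 50 ∧ dist v w ≤ 1 + 1 / 50}.ncard ≤ 3 →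
        ∀ w₁ ∈ Y, ∀ w₂ ∈ Y, ∀ w₃ ∈ Y,
          w₁ ≠ 0 → w₁ ≠ v → ‖w₁‖ ≤ 1 + 1 / 50 → dist v w₁ ≤ 1 + 1 / 50 →
          w₂ ≠ 0 → w₂ ≠ v → ‖w₂‖ ≤ 1 + 1 / 50 → dist v w₂ ≤ 1 + 1 / 50 →
          w₃ ≠ 0 → w₃ ≠ v → ‖w₃‖ ≤ 1 + 1 / 50 → dist v w₃ ≤ 1 + 1 / 50 →
          w₁ ≠ w₂ → w₁ ≠ w₃ → w₂ ≠ w₃ →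
          dist w₁ w₂ ≤ 1 + 1 / 50 → dist w₂ w₃ ≤ 1 + 1 / 50 →
          False) →
    (∀ (Y : Set (EuclideanSpace ℝ (Fin 3))), Y.Finite → (0 : EuclideanSpace ℝ (Fin 3)) ∈ Y →
      (∀ p ∈ Y, ∀ q ∈ Y, p ≠ q → 1 - 1 / 50 ≤ dist p q ∧
        (dist p q ≤ 1 + 1 / 50 ∨ 63 / 50 ≤ dist p q)) →
      (∀ z ∈ Y, {w ∈ Y | w ≠ z ∧ dist z w ≤ 1 + 1 / 50}.ncard ≤ 12) →
      (∀ z ∈ Y, ‖z‖ ≤ 3 → {w ∈ Y | w ≠ z ∧ dist z w ≤ 1 + 1 / 50}.ncard = 12) →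
      ∀ v ∈ Y, v ≠ 0 → ‖v‖ ≤ 1 + 1 / 50 →
        {w ∈ Y | w ≠ 0 ∧ w ≠ v ∧ ‖w‖ ≤ 1 + 1 / 50 ∧ dist v w ≤ 1 + 1 / 50}.ncard ≤ 3 →
        ∀ w₁ ∈ Y, ∀ w₂ ∈ Y, ∀ w₃ ∈ Y,
          w₁ ≠ 0 → w₁ ≠ v → ‖w₁‖ ≤ 1 + 1 / 50 → dist v w₁ ≤ 1 + 1 / 50 →
          w₂ ≠ 0 → w₂ ≠ v → ‖w₂‖ ≤ 1 + 1 / 50 → dist v w₂ ≤ 1 + 1 / 50 →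
          w₃ ≠ 0 → w₃ ≠ v → ‖w₃‖ ≤ 1 + 1 / 50 → dist v w₃ ≤ 1 + 1 / 50 →
          w₁ ≠ w₂ → w₁ ≠ w₃ → w₂ ≠ w₃ →
          63 / 50 ≤ dist w₁ w₃ → 63 / 50 ≤ dist w₂ w₃ →
          False) →
    ∀ (Y : Set (EuclideanSpace ℝ (Fin 3))), Y.Finite → (0 : EuclideanSpace ℝ (Fin 3)) ∈ Y →
      (∀ p ∈ Y, ∀ q ∈ Y, p ≠ q → 1 - 1 / 50 ≤ dist p q ∧
        (dist p q ≤ 1 + 1 / 50 ∨ 63 / 50 ≤ dist p q)) →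
      (∀ z ∈ Y, {w ∈ Y | w ≠ z ∧ dist z w ≤ 1 + 1 / 50}.ncard ≤ 12) →
      (∀ z ∈ Y, ‖z‖ ≤ 3 → {w ∈ Y | w ≠ z ∧ dist z w ≤ 1 + 1 / 50}.ncard = 12) →
      ∀ v ∈ Y, v ≠ 0 → ‖v‖ ≤ 1 + 1 / 50 →
        {w ∈ Y | w ≠ 0 ∧ w ≠ v ∧ ‖w‖ ≤ 1 + 1 / 50 ∧ dist v w ≤ 1 + 1 / 50}.ncard ≤ 3 →
        False := by
  intro stub_tfNoSparseBondUnit stub_tfNoHubTriadUnit stub_tfNoFarTriadUnit Y hfin h0 hgap hle htw v hv hv0 hdv h3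
  set C : Set (EuclideanSpace ℝ (Fin 3)) :=
    {w ∈ Y | w ≠ 0 ∧ w ≠ v ∧ ‖w‖ ≤ 1 + 1 / 50 ∧ dist v w ≤ 1 + 1 / 50} with hC
  rcases Nat.lt_or_ge C.ncard 3 with hlt | hge
  · -- class 1: at most two commons
    have h2 : C.ncard ≤ 2 := by omega
    exact stub_tfNoSparseBondUnit Y hfin h0 hgap hle htw v hv hv0 hdv h2
  · have hC3 : C.ncard = 3 := le_antisymm h3 hge
    obtain ⟨w₁, w₂, w₃, h12, h13, h23, hCeq⟩ := Set.ncard_eq_three.mp hC3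
    have hw₁ : w₁ ∈ C := by rw [hCeq]; simp
    have hw₂ : w₂ ∈ C := by rw [hCeq]; simp
    have hw₃ : w₃ ∈ C := by rw [hCeq]; simp
    -- ALLGAP: two distinct commons that are not bonded are far
    have far_uu : ∀ u ∈ C, ∀ u' ∈ C, u ≠ u' → ¬ dist u u' ≤ 1 + 1 / 50 →
        63 / 50 ≤ dist u u' := fun u hu u' hu' h hn =>
      ((hgap u hu.1 u' hu'.1 h).2).resolve_left hn
    -- class 2: a hub `u₂` bonded to `u₁` and `u₃`
    have hub : ∀ u₁ u₂ u₃, u₁ ∈ C → u₂ ∈ C → u₃ ∈ C → u₁ ≠ u₂ → u₁ ≠ u₃ → u₂ ≠ u₃ →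
        dist u₁ u₂ ≤ 1 + 1 / 50 → dist u₂ u₃ ≤ 1 + 1 / 50 → False := by
      intro u₁ u₂ u₃ hu₁ hu₂ hu₃ hn12 hn13 hn23 hd12 hd23
      exact stub_tfNoHubTriadUnit Y hfin h0 hgap hle htw v hv hv0 hdv h3
        u₁ hu₁.1 u₂ hu₂.1 u₃ hu₃.1
        hu₁.2.1 hu₁.2.2.1 hu₁.2.2.2.1 hu₁.2.2.2.2
        hu₂.2.1 hu₂.2.2.1 hu₂.2.2.2.1 hu₂.2.2.2.2
        hu₃.2.1 hu₃.2.2.1 hu₃.2.2.2.1 hu₃.2.2.2.2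
        hn12 hn13 hn23 hd12 hd23
    -- class 3: `u₃` bonded to neither `u₁` nor `u₂`
    have far : ∀ u₁ u₂ u₃, u₁ ∈ C → u₂ ∈ C → u₃ ∈ C → u₁ ≠ u₂ → u₁ ≠ u₃ → u₂ ≠ u₃ →
        ¬ dist u₁ u₃ ≤ 1 + 1 / 50 → ¬ dist u₂ u₃ ≤ 1 + 1 / 50 → False := by
      intro u₁ u₂ u₃ hu₁ hu₂ hu₃ hn12 hn13 hn23 hf13 hf23
      exact stub_tfNoFarTriadUnit Y hfin h0 hgap hle htw v hv hv0 hdv h3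
        u₁ hu₁.1 u₂ hu₂.1 u₃ hu₃.1
        hu₁.2.1 hu₁.2.2.1 hu₁.2.2.2.1 hu₁.2.2.2.2
        hu₂.2.1 hu₂.2.2.1 hu₂.2.2.2.1 hu₂.2.2.2.2
        hu₃.2.1 hu₃.2.2.1 hu₃.2.2.2.1 hu₃.2.2.2.2
        hn12 hn13 hn23 (far_uu u₁ hu₁ u₃ hu₃ hn13 hf13) (far_uu u₂ hu₂ u₃ hu₃ hn23 hf23)
    -- the bond graph on `{w₁, w₂, w₃}` has a vertex of degree 2 or a vertex of degree 0
    by_cases b12 : dist w₁ w₂ ≤ 1 + 1 / 50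
    · by_cases b23 : dist w₂ w₃ ≤ 1 + 1 / 50
      · exact hub w₁ w₂ w₃ hw₁ hw₂ hw₃ h12 h13 h23 b12 b23                       -- hub w₂
      · by_cases b13 : dist w₁ w₃ ≤ 1 + 1 / 50
        · refine hub w₂ w₁ w₃ hw₂ hw₁ hw₃ h12.symm h23 h13 ?_ b13                -- hub w₁
          rwa [dist_comm] at b12
        · exact far w₁ w₂ w₃ hw₁ hw₂ hw₃ h12 h13 h23 b13 b23                     -- w₃ isolated
    · by_cases b23 : dist w₂ w₃ ≤ 1 + 1 / 50
      · by_cases b13 : dist w₁ w₃ ≤ 1 + 1 / 50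
        · refine hub w₁ w₃ w₂ hw₁ hw₃ hw₂ h13 h12 h23.symm b13 ?_                -- hub w₃
          rwa [dist_comm] at b23
        · refine far w₂ w₃ w₁ hw₂ hw₃ hw₁ h23 h12.symm h13.symm ?_ ?_            -- w₁ isolated
          · rwa [dist_comm] at b12
          · rwa [dist_comm] at b13
      · refine far w₁ w₃ w₂ hw₁ hw₃ hw₂ h13 h12 h23.symm b12 ?_                  -- w₂ isolated
        rwa [dist_comm] at b23

end Summit.AtomisticToContinuum.Crystallization.Theorems

end
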